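import Literature.AlgebraicGeometry.Resolution.Blowups
import Literature.AlgebraicGeometry.Resolution.NearPointsSigmaLocal
import HarnessLib

/-!
# [OURS · L1 W4.5(b) · EL♮(3)] HSUB′(ReachTower₂)₃ — topology of the DOWNSTAIRS SIDE FACTS carried next to `Tower.Inv₂` in the assembly
# (`IsClosed K`, `K ⊆ closure (K ∖ E)`, `K ≠ univ` through the tower constructors)

res-D-pv-029 g8 (HSUB′(ReachTower)₃ ASSEMBLY). OURS; NOT a statement of any manuscript; AI-written, weaker than expert review. No `sorry`;
standard axioms. DEF-FREE. `--supports stmt-ResolutionOfSingularities-20148 --as helper`.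

WHAT. Three small facts about a blow-up `υ₂ : G′ → G` of a centre supported on a proper closed `C` of an irreducible `G` (an isomorphism off
`C`, Görtz–Wedhorn Prop. 13.91 (3)): `closure_preimage_ne_univ` (a closure inside `υ₂⁻¹K`, `K ≠ G` closed, is `≠ G′`),
`closure_preimage_diff_subset_closure_diff_preimage` (`closure υ₂⁻¹(K ∖ C)` is dense off the NEW surface `υ₂⁻¹C`),
`closure_preimage_diff_subset_of_isBlowup` (if `K ⊆ closure (K ∖ E)` then `closure υ₂⁻¹(K ∖ C)` is dense off the TRANSPORTED surface
`closure υ₂⁻¹(E ∖ C)` — the open-embedding `υ₂⁻¹(G ∖ C) → G`).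
-/

set_option linter.dupNamespace false -- mandated namespace `Summit.<Summit>.<Problem>` of this single-conjunct summit

noncomputable section

open CategoryTheory AlgebraicGeometry TopologicalSpace Topology
open Literature.AlgebraicGeometry.Resolution
open AlgebraicGeometry.Scheme.IdealSheafData

namespace Summit.ResolutionOfSingularities.ResolutionOfSingularities.Cruxes.EquisingularLiftNat.Sections

/-! ## Small topology for the downstairs side facts of `INV₁` -/

/-- A closure inside the preimage of a proper closed subset is proper, when the base is irreducible and the map hits every point off a
proper closed `C`. [folklore] -/
theorem closure_preimage_ne_univ {G G' : Scheme.{0}} [IsIntegral G] (υ₂ : G' ⟶ G) (D : G.IdealSheafData) (hυ₂ : IsBlowup υ₂ D)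
    (K C : Set G) (hKcl : IsClosed K) (hK : K ≠ Set.univ) (hC : IsClosed C) (hCne : C ≠ Set.univ) (hD : (D.support : Set G) ⊆ C)
    (A : Set G') (hA : A ⊆ υ₂ ⁻¹' K) : closure A ≠ Set.univ := by
  intro hAu
  -- a point of `G` off `K ∪ C` (irreducibility)
  have hirr : IsIrreducible (Set.univ : Set G) := IrreducibleSpace.isIrreducible_univ G
  have hKo : (Kᶜ).Nonempty := Set.nonempty_compl.mpr hK
  have hCo : (Cᶜ).Nonempty := Set.nonempty_compl.mpr hCne
  obtain ⟨g, -, hgK, hgC⟩ := hirr.isPreirreducible Kᶜ Cᶜ hKcl.isOpen_compl hC.isOpen_compl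
    (by obtain ⟨a, ha⟩ := hKo; exact ⟨a, trivial, ha⟩) (by obtain ⟨a, ha⟩ := hCo; exact ⟨a, trivial, ha⟩)
  obtain ⟨g', hg'⟩ := hυ₂.exists_preimage_of_not_mem_support (z := g) (fun h => hgC (hD h))
  have h1 : g' ∈ closure A := by rw [hAu]; trivial
  have h2 : g' ∈ υ₂ ⁻¹' K := closure_minimal hA (hKcl.preimage υ₂.continuous) h1
  rw [Set.mem_preimage, hg'] at h2
  exact hgK h2

/-- The shadow transported as `closure υ₂⁻¹(K ∖ C)` is dense off the NEW surface `υ₂⁻¹ C`. [folklore] -/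
theorem closure_preimage_diff_subset_closure_diff_preimage {G G' : Scheme.{0}} (υ₂ : G' ⟶ G) (K C : Set G) :
    closure (υ₂ ⁻¹' (K \ C)) ⊆ closure (closure (υ₂ ⁻¹' (K \ C)) \ υ₂ ⁻¹' C) := by
  refine closure_minimal (fun g hg => subset_closure ⟨subset_closure hg, fun h => hg.2 h⟩) isClosed_closure


/-- **The shadow stays dense off the TRANSPORTED surface through a blow-up** (an isomorphism off its centre): if `K ⊆ closure (K ∖ E)`
downstairs (`K`, `E` closed), then `closure υ₂⁻¹(K ∖ C) ⊆ closure (closure υ₂⁻¹(K ∖ C) ∖ closure υ₂⁻¹(E ∖ C))` for `C` the support of the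
centre. Topology + Görtz–Wedhorn Prop. 13.91 (3) (`IsBlowup.isIso_morphismRestrict`). [cite: GortzWedhorn2020, Prop. 13.91 (3)] -/
theorem closure_preimage_diff_subset_of_isBlowup {G G' : Scheme.{0}} (υ₂ : G' ⟶ G) (D : G.IdealSheafData) (hυ₂ : IsBlowup υ₂ D)
    (K E : Set G) (hEcl : IsClosed E) (hKE : K ⊆ closure (K \ E)) :
    closure (υ₂ ⁻¹' (K \ (D.support : Set G))) ⊆
      closure (closure (υ₂ ⁻¹' (K \ (D.support : Set G))) \ closure (υ₂ ⁻¹' (E \ (D.support : Set G)))) := by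
  set U : G.Opens := ⟨(D.support : Set G)ᶜ, D.support.isClosed.isOpen_compl⟩ with hU
  haveI : IsIso (υ₂ ∣_ U) := hυ₂.isIso_morphismRestrict (U := U) disjoint_compl_left
  have hoe : IsOpenEmbedding ((υ₂ ⁻¹ᵁ U).ι ≫ υ₂) := by
    rw [← morphismRestrict_ι]
    exact ((υ₂ ∣_ U) ≫ U.ι).isOpenEmbedding
  -- the open preimage of `K ∖ C` is inside the closure of its part off `υ₂⁻¹ E`
  have hA : υ₂ ⁻¹' (K \ (D.support : Set G)) ⊆ closure (υ₂ ⁻¹' (K \ (D.support : Set G)) \ υ₂ ⁻¹' E) := by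
    intro a ha
    rw [mem_closure_iff]
    intro V' hV' haV'
    -- the image of `V' ∩ υ₂⁻¹U` is open in `G`
    have hopen : IsOpen (((υ₂ ⁻¹ᵁ U).ι ≫ υ₂) '' ((υ₂ ⁻¹ᵁ U).ι ⁻¹' V')) :=
      hoe.isOpenMap _ (hV'.preimage (υ₂ ⁻¹ᵁ U).ι.continuous)
    have haU : a ∈ (υ₂ ⁻¹ᵁ U : Set G') := by
      change υ₂ a ∈ (D.support : Set G)ᶜ
      exact ha.2
    obtain ⟨a₀, ha₀⟩ : a ∈ Set.range (υ₂ ⁻¹ᵁ U).ι := by rw [Scheme.Opens.range_ι]; exact haU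
    have hmem : υ₂ a ∈ ((υ₂ ⁻¹ᵁ U).ι ≫ υ₂) '' ((υ₂ ⁻¹ᵁ U).ι ⁻¹' V') :=
      ⟨a₀, by rw [Set.mem_preimage, ha₀]; exact haV', by rw [Scheme.Hom.comp_apply, ha₀]⟩
    -- `K ⊆ closure (K ∖ E)` gives a point of `K ∖ E` in that open image
    obtain ⟨g, hgV, hgK, hgE⟩ := mem_closure_iff.mp (hKE ha.1) _ hopen hmem
    obtain ⟨a₁, ha₁V, rfl⟩ := hgV
    refine ⟨(υ₂ ⁻¹ᵁ U).ι a₁, ha₁V, ⟨?_, ?_⟩, ?_⟩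
    · show υ₂ ((υ₂ ⁻¹ᵁ U).ι a₁) ∈ K
      rw [← Scheme.Hom.comp_apply]; exact hgK
    · have h1 : (υ₂ ⁻¹ᵁ U).ι a₁ ∈ (υ₂ ⁻¹ᵁ U : Set G') := by
        rw [← Scheme.Opens.range_ι]; exact ⟨a₁, rfl⟩
      intro h2
      exact h1 h2
    · change υ₂ ((υ₂ ⁻¹ᵁ U).ι a₁) ∉ E
      rw [← Scheme.Hom.comp_apply]; exact hgE
  have hEsub : closure (υ₂ ⁻¹' (E \ (D.support : Set G))) ⊆ υ₂ ⁻¹' E :=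
    closure_minimal (Set.preimage_mono fun z hz => hz.1) (hEcl.preimage υ₂.continuous)
  refine closure_minimal (hA.trans (closure_mono fun a ha => ⟨subset_closure ha.1, fun h => ha.2 (hEsub h)⟩)) isClosed_closure

end Summit.ResolutionOfSingularities.ResolutionOfSingularities.Cruxes.EquisingularLiftNat.Sections

end
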